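import Mathlib
import HarnessLib
import Summits.KontsevichZagierPeriods.KontsevichZagierPeriods.Theses.LinRedNormalForm
import Summits.KontsevichZagierPeriods.KontsevichZagierPeriods.Theorems.LinRedNormalFormDihedralNormalFormStubAtomUncrossThreeAux1

/-!
# `DihedralNormalForm`, line `torus-descent-sum-shadow`: the UNCROSS move in dimension three

Support file for the residual stub `stub_unnesting` of the crux `DihedralNormalForm`
(stmt-KontsevichZagierPeriods-3912, route `LinRedNormalForm`): the tool stub `atomUncrossThree`.
For a cubical atom `[□³, q·xᵃ·∏_{i≤j}(1 - x_{[i,j]})^{e i j}]` whose long chord `[0,2]` is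
inactive (`e 0 2 = 0`), dissecting along `x₀ ≶ x₂` (rule 1a), folding each piece back onto the
cube by `x₀ = w·x₂`, resp. `x₂ = w·x₀` (rule 2, monomial, Jacobian `x₂`, resp. `x₀`) and
reordering the coordinates as `(x₁, x₂, w)`, resp. `(x₁, x₀, w)` (rule 2, a permutation) gives
the identity between atoms
`[a; b₀,b₁,b₂; e₀₁,e₁₂,0] = [(a₁,a₀+a₂+1,a₀); (b₁,b₂,0); e'₀₁=e₁₂, e'₁₂=b₀, e'₀₂=e₀₁]`
`                         + [(a₁,a₀+a₂+1,a₂); (b₁,b₀,0); e'₀₁=e₀₁, e'₁₂=b₂, e'₀₂=e₁₂]`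
(`bᵢ = e i i`): the crossing pair `[0,1],[1,2]` is traded for the nested pairs
`[0,1]',[0,2]'` plus the numerator chord `[1,2]'^{b₀}` (resp. `^{b₂}`).

References: M. Kontsevich, D. Zagier, *Periods* (2001), §1.2 (rules (1), (2)).
-/

noncomputable section

open MeasureTheory Set
open Literature.ModelTheory.ExponentialFields (IsSemialgebraic)

namespace Summit.KontsevichZagierPeriods.DihedralNormalForm.TorusDescent

open Literature.NumberTheory.Transcendental
open Literature.ModelTheory.ExponentialFields

/-! ### The atom integrand in dimension three and the two fold identities -/

/-- The cubical atom integrand in dimension `3`, expanded. [folklore] -/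
theorem atomFun_three (a : Fin 3 → ℕ) (e : Fin 3 → Fin 3 → ℤ) (x : Fin 3 → ℝ) :
    atomFun a e x = x 0 ^ a 0 * x 1 ^ a 1 * x 2 ^ a 2 *
      ((1 - x 0) ^ e 0 0 * (1 - x 0 * x 1) ^ e 0 1 * (1 - x 0 * x 1 * x 2) ^ e 0 2 *
        ((1 - x 1) ^ e 1 1 * (1 - x 1 * x 2) ^ e 1 2) * (1 - x 2) ^ e 2 2) := by
  simp [atomFun, Fin.prod_univ_three]

/-- The fold identity on the piece `{x₀ < x₂}`: `q·g(y₂y₁, y₀, y₁)·y₁` is the first uncrossed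
atom at `y`. [folklore] -/
theorem uncross_identity₁ (q : ℚ) (a : Fin 3 → ℕ) (e : Fin 3 → Fin 3 → ℤ) (he : e 0 2 = 0)
    (y : Fin 3 → ℝ) :
    (q : ℝ) * atomFun a e ![y 2 * y 1, y 0, y 1] * y 1 =
      (q : ℝ) * atomFun ![a 1, a 0 + a 2 + 1, a 0]
        ![![e 1 1, e 1 2, e 0 1], ![0, e 2 2, e 0 0], ![0, 0, 0]] y := by
  rw [atomFun_three, atomFun_three]
  simp only [Matrix.cons_val_zero, Matrix.cons_val_one, Matrix.cons_val_two, Matrix.head_cons,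
    Matrix.tail_cons, he, zpow_zero, mul_one]
  have h1 : (1 : ℝ) - y 2 * y 1 = 1 - y 1 * y 2 := by ring
  have h2 : (1 : ℝ) - y 2 * y 1 * y 0 = 1 - y 0 * y 1 * y 2 := by ring
  rw [h1, h2]
  ring

/-- The fold identity on the piece `{x₂ < x₀}` (read through the reversal): `q·g(y₁, y₀, y₂y₁)·y₁`
is the second uncrossed atom at `y`. [folklore] -/
theorem uncross_identity₂ (q : ℚ) (a : Fin 3 → ℕ) (e : Fin 3 → Fin 3 → ℤ) (he : e 0 2 = 0)
    (y : Fin 3 → ℝ) :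
    (q : ℝ) * atomFun a e ![y 1, y 0, y 2 * y 1] * y 1 =
      (q : ℝ) * atomFun ![a 1, a 0 + a 2 + 1, a 2]
        ![![e 1 1, e 0 1, e 1 2], ![0, e 0 0, e 2 2], ![0, 0, 0]] y := by
  rw [atomFun_three, atomFun_three]
  simp only [Matrix.cons_val_zero, Matrix.cons_val_one, Matrix.cons_val_two, Matrix.head_cons,
    Matrix.tail_cons, he, zpow_zero, mul_one]
  have h1 : (1 : ℝ) - y 1 * y 0 = 1 - y 0 * y 1 := by ring
  have h2 : (1 : ℝ) - y 0 * (y 2 * y 1) = 1 - y 0 * y 1 * y 2 := by ring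
  have h3 : (1 : ℝ) - y 2 * y 1 = 1 - y 1 * y 2 := by ring
  rw [h1, h2, h3]
  ring

/-! ### The reordering permutation -/

/-- The reordering `(z₀, z₁, z₂) ↦ (z₁, z₂, z₀)` read as `w ↦ (w 2, w 0, w 1)`. -/
theorem rot_perm_exists : ∃ π : Equiv.Perm (Fin 3), π 0 = 2 ∧ π 1 = 0 ∧ π 2 = 1 :=
  ⟨⟨![2, 0, 1], ![1, 2, 0], by decide, by decide⟩, rfl, rfl, rfl⟩

/-- The folded point of piece one, read in the new coordinates. [folklore] -/
theorem fold_point₁ (π : Equiv.Perm (Fin 3)) (h0 : π 0 = 2) (h1 : π 1 = 0) (h2 : π 2 = 1)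
    (w : Fin 3 → ℝ) :
    Function.update (fun i => w (π i)) (Fin.castSucc (0 : Fin 2))
        ((fun i => w (π i)) (Fin.castSucc (0 : Fin 2)) * (fun i => w (π i)) (Fin.last 2)) =
      ![w 2 * w 1, w 0, w 1] := by
  have hc : (Fin.castSucc (0 : Fin 2) : Fin 3) = 0 := rfl
  have hl : (Fin.last 2 : Fin 3) = 2 := rfl
  ext i
  fin_cases i
  · simp [hc, hl, h0, h2]
  · simp [hc, h1]
  · simp [hc, h2]

/-- The folded point of piece two (after the reversal), read in the new coordinates. [folklore] -/
theorem fold_point₂ (π : Equiv.Perm (Fin 3)) (h0 : π 0 = 2) (h1 : π 1 = 0) (h2 : π 2 = 1)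
    (w : Fin 3 → ℝ) :
    (fun i => Function.update (fun i => w (π i)) (Fin.castSucc (0 : Fin 2))
        ((fun i => w (π i)) (Fin.castSucc (0 : Fin 2)) * (fun i => w (π i)) (Fin.last 2))
        (Fin.revPerm i)) = ![w 1, w 0, w 2 * w 1] := by
  have hc : (Fin.castSucc (0 : Fin 2) : Fin 3) = 0 := rfl
  have hl : (Fin.last 2 : Fin 3) = 2 := rfl
  have hr0 : Fin.rev (0 : Fin 3) = 2 := rfl
  have hr1 : Fin.rev (1 : Fin 3) = 1 := rfl
  have hr2 : Fin.rev (2 : Fin 3) = 0 := rfl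
  ext i
  fin_cases i
  · simp [hc, hr0, h2]
  · simp [hc, hr1, h1]
  · simp [hc, hl, hr2, h0, h2]

/-- Points with coordinates in `(0,1)` have products in `(0,1)`. [folklore] -/
theorem mul_mem_Ioo {u v : ℝ} (hu : u ∈ Ioo (0:ℝ) 1) (hv : v ∈ Ioo (0:ℝ) 1) :
    u * v ∈ Ioo (0:ℝ) 1 :=
  ⟨mul_pos hu.1 hv.1, mul_lt_one_of_nonneg_of_lt_one_left hu.1.le hu.2 hv.2.le⟩

/-- The domain of a cube representation reindexed along a permutation is the cube. [folklore] -/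
theorem reindex_cube_domain {n : ℕ} (r : KZ.IntegralRep n) (π : Equiv.Perm (Fin n))
    (h : r.domain = {x : Fin n → ℝ | ∀ i, x i ∈ Set.Ioo (0:ℝ) 1}) :
    (r.reindex π).domain = {x : Fin n → ℝ | ∀ i, x i ∈ Set.Ioo (0:ℝ) 1} := by
  rw [KZ.IntegralRep.reindex_domain, h]
  ext w
  simp only [mem_setOf_eq]
  constructor
  · intro hw i
    simpa using hw (π.symm i)
  · intro hw i
    exact hw (π i)

/-! ### The move -/

/-- **UNCROSS in dimension three** (tool for the residual stub `stub_unnesting`). A cubical atom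
`[□³, q·xᵃ·∏_{i≤j}(1 - x_{[i,j]})^{e i j}]` with `e 0 2 = 0` is congruent modulo `KZ.relations`
to the sum of the two atoms with data `(a₁, a₀+a₂+1, a₀)`, `e' 0 0 = e 1 1`, `e' 1 1 = e 2 2`,
`e' 2 2 = 0`, `e' 0 1 = e 1 2`, `e' 1 2 = e 0 0`, `e' 0 2 = e 0 1`, and `(a₁, a₀+a₂+1, a₂)`,
`e' 0 0 = e 1 1`, `e' 1 1 = e 0 0`, `e' 2 2 = 0`, `e' 0 1 = e 0 1`, `e' 1 2 = e 2 2`,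
`e' 0 2 = e 1 2` (moves: the dissection `x₀ ≶ x₂`, rule 1a; the folds `x₀ = w x₂`, `x₂ = w x₀`,
rule 2; coordinate reorderings, rule 2). [cite: KontsevichZagier2001, §1.2] -/
theorem atomUncrossThree : ∀ (q : ℚ) (a : Fin 3 → ℕ) (e : Fin 3 → Fin 3 → ℤ) (s : Literature.NumberTheory.Transcendental.KZ.IntegralRep 3), s.domain = {x : Fin 3 → ℝ | ∀ i, x i ∈ Set.Ioo (0:ℝ) 1} → Set.EqOn s.integrand (fun x => (q : ℝ) * ((∏ i : Fin 3, x i ^ a i) * ∏ i : Fin 3, ∏ j : Fin 3, if i ≤ j then (1 - (∏ l : Fin 3, if i ≤ l ∧ l ≤ j then x l else 1)) ^ e i j else 1)) s.domain → e 0 2 = 0 → ∃ s₁ s₂ : Literature.NumberTheory.Transcendental.KZ.IntegralRep 3, s₁.domain = {x : Fin 3 → ℝ | ∀ i, x i ∈ Set.Ioo (0:ℝ) 1} ∧ Set.EqOn s₁.integrand (fun x => (q : ℝ) * ((∏ i : Fin 3, x i ^ (![a 1, a 0 + a 2 + 1, a 0] : Fin 3 → ℕ) i) * ∏ i : Fin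 3, ∏ j : Fin 3, if i ≤ j then (1 - (∏ l : Fin 3, if i ≤ l ∧ l ≤ j then x l else 1)) ^ (![![e 1 1, e 1 2, e 0 1], ![0, e 2 2, e 0 0], ![0, 0, 0]] : Fin 3 → Fin 3 → ℤ) i j else 1)) s₁.domain ∧ s₂.domain = {x : Fin 3 → ℝ | ∀ i, x i ∈ Set.Ioo (0:ℝ) 1} ∧ Set.EqOn s₂.integrand (fun x => (q : ℝ) * ((∏ i : Fin 3, x i ^ (![a 1, a 0 + a 2 + 1, a 2] : Fin 3 → ℕ) i) * ∏ i : Fin 3, ∏ j : Fin 3, if i ≤ j then (1 - (∏ l : Fin 3, if i ≤ l ∧ l ≤ j then x l else 1)) ^ (![![e 1 1, e 0 1, e 1 2], ![0, e 0 0, e 2 2], ![0, 0, 0]] : Fin 3 → Fin 3 → ℤ) i j else 1)) s₂.domain ∧ Literature.NumberTheory.Transcendental.KZ.of s - Literature.NumberTheory.Transcendental.KZ.of s₁ - Literature.NumberTheory.Transcendental.KZ.of s₂ ∈ Literature.NumberTheory.Transcendental.KZ.relations := by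
  intro q a e s hdom hint he
  obtain ⟨π, h0, h1, h2⟩ := rot_perm_exists
  have hc : (Fin.castSucc (0 : Fin 2) : Fin 3) = 0 := rfl
  have hl : (Fin.last 2 : Fin 3) = 2 := rfl
  -- rule 1a: dissect along `x₀ ≶ x₂`
  obtain ⟨r₁, r₂, hr₁d, hr₁i, hr₂d, hr₂i, hrel⟩ :=
    cubeDissectPair 3 0 2 (by decide) s hdom
  -- rule 2: fold piece one
  obtain ⟨t₁, ht₁d, ht₁i, ht₁rel⟩ := cubeFold 2 0 r₁ hr₁d
  -- rule 2: reverse, then fold piece two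
  have hρd : (r₂.reindex Fin.revPerm).domain = {x : Fin 3 → ℝ | (∀ i, x i ∈ Set.Ioo (0:ℝ) 1) ∧
      x (Fin.castSucc (0 : Fin 2)) < x (Fin.last 2)} := by
    rw [KZ.IntegralRep.reindex_domain, hr₂d, hc, hl]
    ext w
    simp only [mem_setOf_eq, Fin.revPerm_apply]
    have hr0 : Fin.rev (0 : Fin 3) = 2 := rfl
    have hr2 : Fin.rev (2 : Fin 3) = 0 := rfl
    rw [hr0, hr2]
    refine and_congr_left fun _ => ⟨fun hw i => ?_, fun hw i => hw _⟩
    simpa [Fin.rev_rev] using hw (Fin.rev i)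
  obtain ⟨t₂, ht₂d, ht₂i, ht₂rel⟩ := cubeFold 2 0 (r₂.reindex Fin.revPerm) hρd
  -- the two output atoms
  refine ⟨t₁.reindex π, t₂.reindex π, reindex_cube_domain t₁ π ht₁d, ?_,
    reindex_cube_domain t₂ π ht₂d, ?_, ?_⟩
  · intro w hw
    rw [reindex_cube_domain t₁ π ht₁d] at hw
    rw [KZ.IntegralRep.reindex_integrand]
    show t₁.integrand (fun i => w (π i)) = _
    rw [ht₁i, fold_point₁ π h0 h1 h2, hr₁i]
    have hmem : (![w 2 * w 1, w 0, w 1] : Fin 3 → ℝ) ∈ s.domain := by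
      rw [hdom]
      intro i
      fin_cases i
      · simpa using mul_mem_Ioo (hw 2) (hw 1)
      · simpa using hw 0
      · simpa using hw 1
    rw [hint hmem, hl, h2]
    exact uncross_identity₁ q a e he w
  · intro w hw
    rw [reindex_cube_domain t₂ π ht₂d] at hw
    rw [KZ.IntegralRep.reindex_integrand]
    show t₂.integrand (fun i => w (π i)) = _
    rw [ht₂i, KZ.IntegralRep.reindex_integrand]
    dsimp only
    rw [fold_point₂ π h0 h1 h2, hr₂i]
    have hmem : (![w 1, w 0, w 2 * w 1] : Fin 3 → ℝ) ∈ s.domain := by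
      rw [hdom]
      intro i
      fin_cases i
      · simpa using hw 1
      · simpa using hw 0
      · simpa using mul_mem_Ioo (hw 2) (hw 1)
    rw [hint hmem, hl, h2]
    exact uncross_identity₂ q a e he w
  · have e1 := KZ.of_sub_of_reindex_mem_relations t₁ π
    have e2 := KZ.of_sub_of_reindex_mem_relations t₂ π
    have e3 := KZ.of_sub_of_reindex_mem_relations r₂ Fin.revPerm
    have : KZ.of s - KZ.of (t₁.reindex π) - KZ.of (t₂.reindex π) =
        (KZ.of s - KZ.of r₁ - KZ.of r₂) + (KZ.of r₁ - KZ.of t₁) +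
          (KZ.of t₁ - KZ.of (t₁.reindex π)) + (KZ.of r₂ - KZ.of (r₂.reindex Fin.revPerm)) +
          (KZ.of (r₂.reindex Fin.revPerm) - KZ.of t₂) + (KZ.of t₂ - KZ.of (t₂.reindex π)) := by
      abel
    rw [this]
    exact KZ.relations.add_mem (KZ.relations.add_mem (KZ.relations.add_mem (KZ.relations.add_mem
      (KZ.relations.add_mem hrel ht₁rel) e1) e3) ht₂rel) e2

end Summit.KontsevichZagierPeriods.DihedralNormalForm.TorusDescent
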